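import Literature.Analysis.FluidPDE.HardSphereUniqueness
import HarnessLib

/-!
# Hard-sphere dynamics on the torus: the flow commutes with global translations
(trunk: FluidKinetic / T-KINETIC, item K2; companion to
`Literature.Analysis.FluidPDE.HardSphereUniqueness`)

On the flat torus `T^d` translate every particle's position by the same `a : T^d`, keeping the
velocities: `z ↦ (i ↦ ((z i).1 + a, (z i).2))`. The hard-sphere dynamics is homogeneous: the
minimal-image separation vectors, the hard-sphere domain, contact sets, free flight and the
elastic collision rule are all unchanged, so the translate of a hard-sphere trajectory is a
hard-sphere trajectory (`Kinetic.IsHardSphereTrajectory.posShift`), and — by forward uniqueness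
of trajectories (`Kinetic.IsHardSphereTrajectory.unique_holds`), the group property and the
invariance of the Liouville measure under the flow and under translations — every hard-sphere
flow commutes with the translation Liouville-almost everywhere
(`Kinetic.HardSphereFlow.flow_posShift_ae`). This is the symmetry behind the translation
invariance of the time-`t` law of a translation-invariant initial law (GST 2013 §1.1, §4.2;
CIP 1994 §4.2), used by the hydrodynamic-limit routes (planar / homogeneous symmetry classes).
The proofs follow `HardSphereFlow.flow_comp_perm_ae` line by line.

## References

* I. Gallagher, L. Saint-Raymond, B. Texier, *From Newton to Boltzmann: hard spheres and
  short-range potentials*, EMS (2013), §1.1, §4.1 (Prop. 4.1.1), §4.2.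
* C. Cercignani, R. Illner, M. Pulvirenti, *The Mathematical Theory of Dilute Gases* (1994),
  §4.2, Appendix 4.A.
-/

open MeasureTheory Set Filter Topology
open scoped ENNReal

namespace Literature.Analysis.FluidPDE

noncomputable section

section Kinetic

variable {d : Type*} [Fintype d] {N : ℕ} {ε : ℝ}

/-! ## Translating all positions -/

/-- The minimal-image separation vector is invariant under a common translation of the two
points. [folklore] -/
theorem Torus.geometry_sepVec_add_right (x y a : UnitAddTorus d) :
    (Torus.geometry d).sepVec (x + a) (y + a) = (Torus.geometry d).sepVec x y := by
  simp only [Torus.geometry_sepVec, add_sub_add_right_eq_sub]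

/-- The hard-sphere domain is invariant under a common translation of all positions. [folklore] -/
theorem posShift_mem_hardSphereDomain_iff (a : UnitAddTorus d) (z : Config N d (UnitAddTorus d)) :
    (fun i => ((z i).1 + a, (z i).2) : Config N d (UnitAddTorus d)) ∈
        hardSphereDomain (Torus.geometry d) N ε ↔
      z ∈ hardSphereDomain (Torus.geometry d) N ε := by
  simp only [mem_hardSphereDomain, Torus.geometry_sepVec_add_right]

/-- Contact sets are invariant under a common translation of all positions. [folklore] -/
theorem posShift_mem_contactSet_iff (a : UnitAddTorus d) (z : Config N d (UnitAddTorus d))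
    (i j : Fin N) :
    (fun i => ((z i).1 + a, (z i).2) : Config N d (UnitAddTorus d)) ∈
        contactSet (Torus.geometry d) N ε i j ↔
      z ∈ contactSet (Torus.geometry d) N ε i j := by
  simp only [mem_contactSet, posShift_mem_hardSphereDomain_iff, Torus.geometry_sepVec_add_right]

/-- Translating all positions does not change the collision times of a curve. [folklore] -/
theorem collisionTimes_posShift (a : UnitAddTorus d) (γ : ℝ → Config N d (UnitAddTorus d)) :
    collisionTimes (Torus.geometry d) ε
        (fun t => (fun i => ((γ t i).1 + a, (γ t i).2) : Config N d (UnitAddTorus d))) =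
      collisionTimes (Torus.geometry d) ε γ := by
  ext t
  simp only [mem_collisionTimes, posShift_mem_contactSet_iff]

/-- Free flight commutes with a common translation of all positions (the torus is a commutative
group). [folklore] -/
theorem freeFlight_posShift (a : UnitAddTorus d) (t : ℝ) (z : Config N d (UnitAddTorus d)) :
    freeFlight (Torus.geometry d) t
        (fun i => ((z i).1 + a, (z i).2) : Config N d (UnitAddTorus d)) =
      fun i => ((freeFlight (Torus.geometry d) t z i).1 + a,
        (freeFlight (Torus.geometry d) t z i).2) := by
  funext i
  simp only [freeFlight_apply, Torus.geometry_translate, add_right_comm]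

/-- Incoming pairs are unchanged by a common translation of all positions. [folklore] -/
theorem isIncoming_posShift_iff (a : UnitAddTorus d) (z : Config N d (UnitAddTorus d))
    (i j : Fin N) :
    IsIncoming (Torus.geometry d)
        (fun i => ((z i).1 + a, (z i).2) : Config N d (UnitAddTorus d)) i j ↔
      IsIncoming (Torus.geometry d) z i j := by
  simp only [IsIncoming, Torus.geometry_sepVec_add_right]

/-- The elastic collision of a pair commutes with a common translation of all positions
(`i ≠ j`). [folklore] -/
theorem collidePair_posShift {i j : Fin N} (hij : i ≠ j) (a : UnitAddTorus d)
    (z : Config N d (UnitAddTorus d)) :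
    collidePair (Torus.geometry d) i j
        (fun i => ((z i).1 + a, (z i).2) : Config N d (UnitAddTorus d)) =
      fun k => ((collidePair (Torus.geometry d) i j z k).1 + a,
        (collidePair (Torus.geometry d) i j z k).2) := by
  funext k
  by_cases hkj : k = j
  · subst hkj
    rw [collidePair_apply_right, collidePair_apply_right, Torus.geometry_sepVec_add_right]
  by_cases hki : k = i
  · subst hki
    rw [collidePair_apply_left hkj, collidePair_apply_left hkj, Torus.geometry_sepVec_add_right]
  · rw [collidePair_apply_of_ne hki hkj, collidePair_apply_of_ne hki hkj]

omit [Fintype d] in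
/-- The common translation of all positions is continuous on phase space. [folklore] -/
theorem continuous_posShift (a : UnitAddTorus d) :
    Continuous fun z : Config N d (UnitAddTorus d) =>
      (fun i => ((z i).1 + a, (z i).2) : Config N d (UnitAddTorus d)) := by
  refine continuous_pi fun i => ?_
  exact (((continuous_apply i).fst).add continuous_const).prodMk (continuous_apply i).snd

omit [Fintype d] in
/-- The common translation of all positions is measurable on phase space. [folklore] -/
theorem measurable_posShift (a : UnitAddTorus d) :
    Measurable fun z : Config N d (UnitAddTorus d) =>
      (fun i => ((z i).1 + a, (z i).2) : Config N d (UnitAddTorus d)) := by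
  refine measurable_pi_lambda _ fun i => ?_
  exact (((measurable_pi_apply i).fst).add_const a).prodMk (measurable_pi_apply i).snd

/-- **Translated trajectories are trajectories**: if `γ` is a hard-sphere trajectory on the
torus then so is `t ↦ (i ↦ ((γ t i).1 + a, (γ t i).2))` (the dynamics is homogeneous;
GST 2013 §1.1, §4.2). [folklore] -/
theorem IsHardSphereTrajectory.posShift {γ : ℝ → Config N d (UnitAddTorus d)}
    (h : IsHardSphereTrajectory (Torus.geometry d) ε N γ) (a : UnitAddTorus d) :
    IsHardSphereTrajectory (Torus.geometry d) ε N fun t =>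
      (fun i => ((γ t i).1 + a, (γ t i).2) : Config N d (UnitAddTorus d)) where
  mem t := (posShift_mem_hardSphereDomain_iff a _).2 (h.mem t)
  locFinite b c := by
    rw [collisionTimes_posShift]
    exact h.locFinite b c
  pos_continuous i := (h.pos_continuous i).add continuous_const
  free s t hst hfree := by
    rw [collisionTimes_posShift] at hfree
    rw [freeFlight_posShift, h.free s t hst hfree]
  binary t i j hij hct := by
    rw [posShift_mem_contactSet_iff] at hct
    obtain ⟨huniq, zl, hzl, hin, hγ⟩ := h.binary t i j hij hct
    refine ⟨fun i' j' hij' hct' => huniq i' j' hij' ((posShift_mem_contactSet_iff a _ _ _).1 hct'),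
      ⟨fun i => ((zl i).1 + a, (zl i).2), ?_, (isIncoming_posShift_iff a zl i j).2 hin, ?_⟩⟩
    · exact ((continuous_posShift a).tendsto zl).comp hzl
    · rw [collidePair_posShift hij, hγ]

end Kinetic

/-! ## The flow commutes with translations, almost everywhere -/

section Flow

variable {d : Type*} [Fintype d] {N : ℕ} {ε : ℝ}

namespace HardSphereFlow

/-- On good points whose translate is good, the flow commutes with the translation at all
forward times (both curves are hard-sphere trajectories issued from the translate; forward
uniqueness). [folklore] -/
theorem flow_posShift_of_nonneg (Φ : HardSphereFlow (Torus.geometry d) ε N) (a : UnitAddTorus d)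
    {z : Config N d (UnitAddTorus d)} (hz : z ∈ Φ.good)
    (hza : (fun i => ((z i).1 + a, (z i).2) : Config N d (UnitAddTorus d)) ∈ Φ.good)
    {t : ℝ} (ht : 0 ≤ t) :
    Φ.flow t (fun i => ((z i).1 + a, (z i).2)) =
      fun i => ((Φ.flow t z i).1 + a, (Φ.flow t z i).2) := by
  have h1 : IsHardSphereTrajectory (Torus.geometry d) ε N fun s =>
      Φ.flow s (fun i => ((z i).1 + a, (z i).2)) := Φ.isTrajectory _ hza
  have h2 : IsHardSphereTrajectory (Torus.geometry d) ε N fun s =>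
      (fun i => ((Φ.flow s z i).1 + a, (Φ.flow s z i).2) : Config N d (UnitAddTorus d)) :=
    (Φ.isTrajectory z hz).posShift a
  have h0 : Φ.flow 0 (fun i => ((z i).1 + a, (z i).2)) =
      fun i => ((Φ.flow 0 z i).1 + a, (Φ.flow 0 z i).2) := by
    rw [Φ.flow_zero _ hza, Φ.flow_zero _ hz]
  exact IsHardSphereTrajectory.unique_holds h1 h2 h0 (Set.mem_Ici.2 ht)

/-- The same at backward times, for good `z` whose time-`t` image has a good translate (group
property). [folklore] -/
theorem flow_posShift_of_neg (Φ : HardSphereFlow (Torus.geometry d) ε N) (a : UnitAddTorus d)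
    {z : Config N d (UnitAddTorus d)} (hz : z ∈ Φ.good) {t : ℝ} (ht : t < 0)
    (hw : (fun i => ((Φ.flow t z i).1 + a, (Φ.flow t z i).2) : Config N d (UnitAddTorus d)) ∈
      Φ.good) :
    Φ.flow t (fun i => ((z i).1 + a, (z i).2)) =
      fun i => ((Φ.flow t z i).1 + a, (Φ.flow t z i).2) := by
  have hwg : Φ.flow t z ∈ Φ.good := Φ.mapsTo_good t hz
  have hneg : Φ.flow (-t) (fun i => ((Φ.flow t z i).1 + a, (Φ.flow t z i).2)) =
      fun i => ((z i).1 + a, (z i).2) := by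
    rw [flow_posShift_of_nonneg Φ a hwg hw (by linarith)]
    simp only [Φ.flow_neg_flow t hz]
  calc Φ.flow t (fun i => ((z i).1 + a, (z i).2))
      = Φ.flow t (Φ.flow (-t) (fun i => ((Φ.flow t z i).1 + a, (Φ.flow t z i).2))) := by
        rw [hneg]
    _ = Φ.flow (t + -t) (fun i => ((Φ.flow t z i).1 + a, (Φ.flow t z i).2)) :=
        (Φ.flow_add t (-t) _ hw).symm
    _ = fun i => ((Φ.flow t z i).1 + a, (Φ.flow t z i).2) := by
        rw [add_neg_cancel, Φ.flow_zero _ hw]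

/-- Translating all positions preserves Lebesgue measure on the torus phase space (translation
invariance of Haar measure on `T^d`, factor by factor). [folklore] -/
theorem measurePreserving_posShift_volume (a : UnitAddTorus d) :
    MeasurePreserving (fun z : Config N d (UnitAddTorus d) =>
      (fun i => ((z i).1 + a, (z i).2) : Config N d (UnitAddTorus d))) volume volume := by
  have h1 : MeasurePreserving (fun p : UnitAddTorus d × EuclideanSpace ℝ d => (p.1 + a, p.2))
      volume volume :=
    (measurePreserving_add_right (volume : Measure (UnitAddTorus d)) a).prod
      (MeasurePreserving.id volume)
  haveI : SigmaFinite (volume : Measure (UnitAddTorus d × EuclideanSpace ℝ d)) := inferInstance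
  exact measurePreserving_pi (fun _ : Fin N => (volume : Measure (UnitAddTorus d × EuclideanSpace ℝ d)))
    (fun _ : Fin N => (volume : Measure (UnitAddTorus d × EuclideanSpace ℝ d))) (fun _ => h1)

/-- Translating all positions preserves the Liouville measure (it preserves Lebesgue measure and
the hard-sphere domain). [folklore] -/
theorem measurePreserving_posShift_liouville (a : UnitAddTorus d) :
    MeasurePreserving (fun z : Config N d (UnitAddTorus d) =>
      (fun i => ((z i).1 + a, (z i).2) : Config N d (UnitAddTorus d)))
      (liouville (Torus.geometry d) N ε) (liouville (Torus.geometry d) N ε) := by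
  have hvol := measurePreserving_posShift_volume (d := d) (N := N) a
  have hinv := measurePreserving_posShift_volume (d := d) (N := N) (-a)
  -- the shift is a measurable equivalence with inverse the shift by `-a`
  set e : Config N d (UnitAddTorus d) ≃ᵐ Config N d (UnitAddTorus d) :=
    { toFun := fun z => fun i => ((z i).1 + a, (z i).2)
      invFun := fun z => fun i => ((z i).1 + -a, (z i).2)
      left_inv := fun z => by funext i; simp
      right_inv := fun z => by funext i; simp
      measurable_toFun := hvol.measurable
      measurable_invFun := hinv.measurable } with he
  have hecoe : (e : Config N d (UnitAddTorus d) → Config N d (UnitAddTorus d)) =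
      fun z => fun i => ((z i).1 + a, (z i).2) := rfl
  have hpre : e ⁻¹' hardSphereDomain (Torus.geometry d) N ε =
      hardSphereDomain (Torus.geometry d) N ε := by
    ext z
    rw [Set.mem_preimage, hecoe]
    exact posShift_mem_hardSphereDomain_iff a z
  have key := (hecoe ▸ hvol).restrict_preimage_emb e.measurableEmbedding
    (hardSphereDomain (Torus.geometry d) N ε)
  rw [hpre] at key
  rw [liouville_eq, ← hecoe]
  exact key

/-- Liouville-almost every configuration has a good translate. [folklore] -/
theorem ae_posShift_mem_good (Φ : HardSphereFlow (Torus.geometry d) ε N) (a : UnitAddTorus d) :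
    ∀ᵐ z ∂liouville (Torus.geometry d) N ε,
      (fun i => ((z i).1 + a, (z i).2) : Config N d (UnitAddTorus d)) ∈ Φ.good := by
  have hP := measurePreserving_posShift_liouville (d := d) (N := N) (ε := ε) a
  have h0 : liouville (Torus.geometry d) N ε ((fun z : Config N d (UnitAddTorus d) =>
      (fun i => ((z i).1 + a, (z i).2) : Config N d (UnitAddTorus d))) ⁻¹' Φ.goodᶜ) = 0 := by
    rw [hP.measure_preimage Φ.measurableSet_good.compl.nullMeasurableSet, Φ.measure_compl_good]
  rw [ae_iff]
  exact h0

/-- **Hard-sphere flows on the torus commute with global translations, almost everywhere**: for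
every `a : T^d` and time `t`, `Φ_t (x + a, v) = Φ_t (x, v) + (a, 0)` for Liouville-a.e. initial
datum (homogeneity of the dynamics; GST 2013 §1.1, §4.2 — derived from forward uniqueness of
trajectories, the group property and the invariance of the Liouville measure under the flow and
under translations). [folklore] -/
theorem flow_posShift_ae (Φ : HardSphereFlow (Torus.geometry d) ε N) (a : UnitAddTorus d)
    (t : ℝ) :
    ∀ᵐ z ∂liouville (Torus.geometry d) N ε,
      Φ.flow t (fun i => ((z i).1 + a, (z i).2)) =
        fun i => ((Φ.flow t z i).1 + a, (Φ.flow t z i).2) := by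
  have hP := measurePreserving_posShift_liouville (d := d) (N := N) (ε := ε) a
  have hmeas : MeasurableSet ((fun z : Config N d (UnitAddTorus d) =>
      (fun i => ((z i).1 + a, (z i).2) : Config N d (UnitAddTorus d))) ⁻¹' Φ.goodᶜ) :=
    hP.measurable Φ.measurableSet_good.compl
  have h0 : liouville (Torus.geometry d) N ε ((fun z : Config N d (UnitAddTorus d) =>
      (fun i => ((z i).1 + a, (z i).2) : Config N d (UnitAddTorus d))) ⁻¹' Φ.goodᶜ) = 0 := by
    rw [hP.measure_preimage Φ.measurableSet_good.compl.nullMeasurableSet, Φ.measure_compl_good]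
  have h2 : ∀ᵐ z ∂liouville (Torus.geometry d) N ε,
      (fun i => ((Φ.flow t z i).1 + a, (Φ.flow t z i).2) : Config N d (UnitAddTorus d)) ∈
        Φ.good := by
    have : liouville (Torus.geometry d) N ε (Φ.flow t ⁻¹'
        ((fun z : Config N d (UnitAddTorus d) =>
          (fun i => ((z i).1 + a, (z i).2) : Config N d (UnitAddTorus d))) ⁻¹' Φ.goodᶜ)) = 0 := by
      rw [(Φ.measurePreserving t).measure_preimage hmeas.nullMeasurableSet, h0]
    rw [ae_iff]
    exact this
  filter_upwards [Φ.ae_mem_good, Φ.ae_posShift_mem_good a, h2] with z hz hza hw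
  rcases le_or_gt 0 t with ht | ht
  · exact flow_posShift_of_nonneg Φ a hz hza ht
  · exact flow_posShift_of_neg Φ a hz ht hw

end HardSphereFlow

end Flow

end

end Literature.Analysis.FluidPDE
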